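import Summits.BirchSwinnertonDyer.BirchSwinnertonDyer.Theses.UniversalToricDescent
import Summits.BirchSwinnertonDyer.BirchSwinnertonDyer.Theorems.UniversalToricDescentTwinWanFrameAtThreeMultTresTAllSplitSelfDual
import Summits.BirchSwinnertonDyer.BirchSwinnertonDyer.Theorems.UniversalToricDescentDegreeOnlyTwinSqueeze
import HarnessLib

/-!
# Route `UniversalToricDescent`, ♭B column: the DEGREE-ONLY twin crux ♭B′° `TwinDegreeFrameAtThreeMultTresT`
# (stmt-BirchSwinnertonDyer-22539) BY NAME from the weight-controlled member/frame supply and K1♯† — WITHOUT Hsieh Thm B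

Cell `bsd-wall` (run/shared/lean/pub/bsd-wall/), width seat `bsd-wall-utd-b-w1` (prover g0, 2026-08-29; explicit-unit MINT
AUTOFILL #2 PART 2 (B3): «`stub_thmB` of 22539»); `--supports stmt-BirchSwinnertonDyer-22539` (helper). Theorems only (no
definition, no named fact, no `sorry`); standard axioms.

## What this file proves and why

The registered line `membertower` v16 (sha16 8c09f9fed2825b17, LEAD utd-p2 g18) concludes ♭B′° 22539 as
`p640116 §4 ∘ (5)†`: ♭B′ `TwinWanFrameAtThreeMultTresT` (27401) from the three stubs {`stub_thmB` = Hsieh 2014 Thm B (item 20711,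
PUB BY NAME), `stub_pubMembersFramesCongruence` = fact† `…_odd_nonsplit_wt` (item 23284, PUB BY NAME),
`stub_selfDualMemberRationalInclusionAtThree` = K1♯† (item 23310, RESEARCH)}, then monotonicity ♭B′ ⟹ ♭B′°. In the kernel (4)†/(5)†
(`UniversalToricDescentTwinWanFrameAtThreeMultTresTAllSplitSelfDual`) Hsieh Thm B is used at ONE place: to obtain `μ(L) = 0`
(`∃ i, IsUnit ([Tⁱ]L)`) for the supply's BDP frame `L`, the input `hμL` of the self-dual tower kernel
`twin_exists_forall_C_pow_mul_mem_span_of_cpIntMemberTower_selfDual_of_isTorsion`. But ♭B′°'s DEGREE clause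

  «`X^∅_ac(W′; 𝔭′)` torsion → ∀ g n m, `Ch·R₀⟦T⟧ = (g)` → (g has first unit coefficient at n) → (L has first unit coefficient at m) → m ≤ n»

carries «`L` has first unit coefficient at `m`» — in particular `‖[Tᵐ]L‖ = 1`, i.e. `[Tᵐ]L ∈ R₀ˣ` (`unrIntegers.isUnit_iff_norm_eq_one`) —
as a HYPOTHESIS (by design: at `μ > 0` the clause is vacuous, crux informal (ii); the twin's `μ = 0` is the separate item 20400
`TwinMuZeroAtThree`). So for ♭B′° the tower kernel runs on the clause's own hypothesis and Hsieh Thm B is not needed: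

* §1 `twinDegreeFrameAtThreeMultTresT_of_allSplitWtMembersFrames_of_selfDualMemberRationalInclusion` — ♭B′° BY NAME from the
  weight-controlled consumer-minimal member/frame statement `C_min†` over an all-split `K` (inline, the hypothesis `hC` of (4)† VERBATIM)
  and K1♯† (inline, item 23310's text VERBATIM). Proof = (4)† with the frame chosen from `hC` alone, and, under torsion and at a handed
  profile pair `(g, n)`, `(L, m)`: `hμL := ⟨m, [Tᵐ]L unit⟩`, the tower kernel, then `degreeClause_of_wanClause` (p DegreeOnlyTwinSqueeze §0).
* §2 `twinDegreeFrameAtThreeMultTresT_of_nonsplitWtMembersFrames_of_selfDualMemberRationalInclusion` — ♭B′° from {fact† BY NAME, K1♯†}: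
  §1 ∘ `allSplitWtMembersFrames_of_nonsplitWtMembersFrames` ((4)† §2). This is the composition of a TWO-stub line for 22539
  (`stub_pubMembersFramesCongruence`, `stub_selfDualMemberRationalInclusionAtThree`); `stub_thmB` LEAVES the ♭B′° line (it stays an input
  of ♭B′ 27401 — rational inclusion needs `μ(L) = 0` unconditionally — and of 20400).
* §3 `twinDegreeFrameAtThreeMultTresT_of_selfDualMemberTowerChildren_tail` — the same reading in the route's item vocabulary:
  `TwinCastellaMembersFramesCongruenceOddInput → TwinSelfDualMemberRationalInclusionAtThree → TwinDegreeFrameAtThreeMultTresT`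
  (the tail of glue† 23330 `TwinWanFrameMultTresTOfSelfDualMemberTowerChildren` with its head `TwinHsiehThmBInput` dropped and the
  conclusion weakened to ♭B′°).

HONEST FRAMING: CONDITIONAL on {fact† PUBLISHED reading of [Castella2020JIMJ, Thm. 2.11] + [Skinner2016PacificMC, §2.6] at weights
`≡ 2 (mod 2(p−1)p^{m−1})`, K1♯† RESEARCH (no Eisenstein-side engine in print at `p = 3`)}; items closed 0; nothing is booked; BSD is
proved for no curve by this file.

RESTATE-ROBUST (T1 of pen pss3x g7's sequence T1 → T2 → T3, 2026-08-29T01:06:02Z; width seat bsd-wall-utd-b-w1 g2): §1 — the only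
proof of this module that APPLIES `hK1 : TwinSelfDualMemberRationalInclusionAtThree` — carries a two-branch `first | … | …` at that
application: branch 1 while item 23310 is K1♯† as filed (rev 73–78), branch 2 (one more argument, the très-ramifié binder `hndvd`) once
the pen restates it to K1♯†_T (T2); §2/§3 pass `hK1` through unopened. Statements unchanged; exactly one branch elaborates at any route rev.

References: [Castella2018Erratum] §2 (p. 2), Thm. 1.1 (iii)(iv), proof (a)(b)(c) (p. 4); [Castella2020JIMJ] Def. 2.10, Thm. 2.11;
[Skinner2016PacificMC] §2.6 (2-6-1), §3.1; [GreenbergVatsal2000] Thm. (1.4) (λ read on unit profiles); [JetchevSkinnerWan2017] §5.1, §7.4.1.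
-/

noncomputable section

set_option linter.dupNamespace false
set_option autoImplicit false

open scoped Classical

namespace Summit.BirchSwinnertonDyer.BirchSwinnertonDyer.Theorems.UniversalToricDescentTwinDegreeFrameAtThreeMultTresTOfSelfDualMemberTower

open PowerSeries WeierstrassCurve NumberField IsDedekindDomain Field
  Literature.NumberTheory.EllipticCurves
  Literature.NumberTheory.EllipticCurves.ModularForms
  Literature.NumberTheory.EllipticCurves.Rank1Residual
  Literature.NumberTheory.EllipticCurves.BigGaloisRep
  Literature.NumberTheory.EllipticCurves.GreenbergSelmer
  Literature.NumberTheory.GaloisRepresentations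
  Summit.BirchSwinnertonDyer.Rank1Residual.X11b
  Summit.BirchSwinnertonDyer.Rank1Residual.X11b.Halves
  Summit.BirchSwinnertonDyer.BirchSwinnertonDyer.Theorems.SchneiderFree
  Summit.BirchSwinnertonDyer.BirchSwinnertonDyer.Theorems.UniversalToricDescentTwinTorsionRankOne
  Summit.BirchSwinnertonDyer.BirchSwinnertonDyer.Theorems.UniversalToricDescentTwinDecLocus
  Summit.BirchSwinnertonDyer.BirchSwinnertonDyer.Theorems.UniversalToricDescentTwinWanFrameAtThreeMultTresTAllSplitSelfDual
  Summit.BirchSwinnertonDyer.BirchSwinnertonDyer.Theorems.UniversalToricDescentKernelDegreeOnlyTwin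
  Summit.BirchSwinnertonDyer.BirchSwinnertonDyer.Theses.UniversalToricDescent

/-! ### §1 ♭B′° from the weight-controlled consumer-minimal member/frame statement `C_min†` + K1♯† (no Hsieh Thm B) -/

-- the dormant branch of a restate-robust `first | … | …` is, by design, never executed at the current route rev
set_option linter.unreachableTactic false in
set_option linter.unusedTactic false in
/-- **♭B′° `TwinDegreeFrameAtThreeMultTresT` (stmt-BirchSwinnertonDyer-22539) BY NAME from the consumer-minimal odd-`p` member/frame
statement WITH WEIGHT CONTROL `C_min†` over an all-split `K` (inline; the hypothesis `hC` of (4)†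
`twinWanFrameAtThreeMultTresT_of_thmB_of_allSplitWtMembersFrames_of_selfDualMemberRationalInclusion` VERBATIM) + K1♯†** (item 23310
`TwinSelfDualMemberRationalInclusionAtThree`, text VERBATIM) — and NOTHING ELSE: no Hsieh Thm B. The frame `(Ω_K, Ω_p, L)` is the
supply's; (dec) for the twin from the très-ramifié binder; under torsion of `X^∅_ac(W′; 𝔭′)` and for a handed unit-profile pair
`(g, n)`, `(L, m)`, the profile of `L` gives `[Tᵐ]L ∈ R₀ˣ` (`unrIntegers.isUnit_iff_norm_eq_one`), hence the `μ(L) = 0` input of the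
self-dual tower kernel `twin_exists_forall_C_pow_mul_mem_span_of_cpIntMemberTower_selfDual_of_isTorsion` (members/frames from `hC`,
their inclusions from K1♯†), which returns the rational Wan clause `∃ k, 3^k·Ch·R₀⟦T⟧ ⊆ (L)`; `degreeClause_of_wanClause` reads
`m ≤ n` off it. CONDITIONAL on {`C_min†` PUBLISHED reading of [Castella2020JIMJ Thm 2.11] + [Skinner2016 §2.6] at weights
`≡ 2 (mod 2(p−1)p^{m−1})`, K1♯† RESEARCH}; nothing is booked; BSD is proved for no curve.
[cite: Castella2020JIMJ, §2 Def. 2.10, Thm. 2.11] [cite: Skinner2016PacificMC, §2.6 (2-6-1), §3.1 (a)(b) (p. 192)]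
[cite: Castella2018Erratum, §2 (p. 2), Thm. 1.1 (iv), proof of Thm. 1.1 (a)(b)(c) (p. 4)] [cite: GreenbergVatsal2000, Thm. (1.4)] -/
theorem twinDegreeFrameAtThreeMultTresT_of_allSplitWtMembersFrames_of_selfDualMemberRationalInclusion
    (hC : ∀ {p : ℕ} [Fact p.Prime] (ι : PadicAlgCl p ≃+* ℂ) (W : WeierstrassCurve ℚ) [W.IsElliptic]
      [W.IsGloballyMinimal] (K : Type) [Field K] [NumberField K]
      (𝔭 : HeightOneSpectrum (𝓞 K)) (κ : ZpExtension K p) (γ : absoluteGaloisGroup K)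
      [Fact (κ.IsTopGenerator γ)] {N : ℕ} [NeZero N] {f : CuspForm (CongruenceSubgroup.Gamma0 N) 2}
      (_ : IsNewformOf W f),
      W.conductorNorm ℤ = N → p ≠ 2 → Mult W p → 3 ≤ N / p → Irr W p →
      IsImaginaryQuadratic K → Odd (NumberField.discr K) → SatisfiesHeegnerHypothesis N K →
      ((Ideal.span {(p : ℤ)}).primesOver (𝓞 K)).ncard = 2 →
      ((p : ℕ) : 𝓞 K) ∈ 𝔭.asIdeal →
      (∀ (w : InfinitePlace K) (x : 𝓞 K), x ∈ 𝔭.asIdeal ↔ ‖ι.symm (w.embedding (x : K))‖ < 1) →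
      κ.IsAnticyclotomic →
      ∀ (a : unrIntegers p →+* PadicComplexInt p) (j : ℤ_[p] →+* unrIntegers p),
        (∀ x : unrIntegers p, ((a x : PadicComplexInt p) : ℂ_[p]) = (x : ℂ_[p])) →
        (∀ x : ℤ_[p], ((j x : unrIntegers p) : ℂ_[p]) = algebraMap ℚ_[p] ℂ_[p] (x : ℚ_[p])) →
      ∃ (ΩK : ℂ) (Ωp : (unrIntegers p)ˣ) (L : UnrSeries p),
        ΩK ≠ 0 ∧ IsBDPLFunction ι 𝔭 κ γ f ΩK ((Ωp : unrIntegers p) : ℂ_[p]) L ∧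
        ∀ m : ℕ, 1 ≤ m →
          ∃ (D : Skinner2016.HidaCongruentMember W p m) (Qm : PowerSeries (PadicComplexInt p)),
            (2 * ((p : ℤ) - 1) * (p : ℤ) ^ (m - 1)) ∣ D.k - 2 ∧
            (∀ x : coeffField D.g, ι (D.ι x) = (x : ℂ)) ∧
            SkinnerUrban2014.IsResiduallyIrreducible D.Δ ∧
            IsBDPLFunctionWtSigmaInt ι 𝔭 κ γ D.g (W.sigmaPlacesFinset p K) ΩK ((Ωp : unrIntegers p) : ℂ_[p]) Qm ∧
            Ideal.span {Qm} ⊔ Ideal.span {(PowerSeries.C (((p : ℕ) : PadicComplexInt p) ^ m))} =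
              Ideal.span {PowerSeries.map a (L * PowerSeries.map j (W.sigmaEulerElement p K κ))} ⊔
                Ideal.span {(PowerSeries.C (((p : ℕ) : PadicComplexInt p) ^ m))})
    (hK1 : TwinSelfDualMemberRationalInclusionAtThree) :
    TwinDegreeFrameAtThreeMultTresT := by
  intro W' _ _ N' _ K _ _ Dt' hmult hsurj hN' hK hH hodd hndvd κ hκ γ _ 𝔭 h𝔭 he hf 𝔭' h𝔭' hne ι' hι'
  -- (dec) from the très-ramifié binder
  have hdec : ∀ Q : (W'.baseChange ℚ_[3]).toAffine.Point, 3 • Q = 0 → Q = 0 :=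
    twin_dec_of_forall_not_cube W' hmult (forall_not_exists_pow_of_nonsplit_or_not_dvd W' (Or.inr hndvd))
  -- the odd-`p` member/frame statement's binders from ♭B′°'s
  have hirr : Irr W' 3 := hasIrreducibleModPGaloisRep_of_hasSurjectiveModNGaloisRep W' 3 hsurj
  have hM : 3 ≤ N' / 3 := by
    have h11 := Pasten2024.eleven_le_level Dt'
    omega
  have hsplit : ((Ideal.span {((3 : ℕ) : ℤ)}).primesOver (𝓞 K)).ncard = 2 :=
    ncard_primesOver_eq_two_of_degreeOne hK.1 h𝔭 he hf
  obtain ⟨ΩK, Ωp, L, hΩK, hL, hmem⟩ := hC ι' W' K 𝔭 κ γ Dt'.isNewformOf hN' (by decide) hmult hM hirr hK hodd hH hsplit h𝔭 hι'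
    hκ (R1.unrToCpInt 3) (toUnr 3) (R1.coe_unrToCpInt 3) (coe_toUnr 3)
  have hΩp' : (((Units.map (R1.unrToCpInt 3 : unrIntegers 3 →* 𝓞_ℂ_[3]) Ωp : (𝓞_ℂ_[3])ˣ) : 𝓞_ℂ_[3]) : ℂ_[3]) =
      ((Ωp : unrIntegers 3) : ℂ_[3]) := by
    rw [Units.coe_map, MonoidHom.coe_coe, R1.coe_unrToCpInt]
  have hΩp0 : ((Ωp : unrIntegers 3) : ℂ_[3]) ≠ 0 := fun h0 ↦
    Ωp.ne_zero ((ZeroMemClass.coe_eq_zero).mp h0)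
  refine ⟨ΩK, ((Ωp : unrIntegers 3) : ℂ_[3]), L, hΩK, hΩp0, hL, fun hT₀ g n m hg hprof hprofL ↦ ?_⟩
  -- `μ(L) = 0` is the clause's OWN hypothesis: `[Tᵐ]L` has norm one, hence is a unit of `R₀`
  have hμL : ∃ i : ℕ, IsUnit (PowerSeries.coeff i L) :=
    ⟨m, (unrIntegers.isUnit_iff_norm_eq_one _).mpr hprofL.2⟩
  -- the rational Wan clause from the self-dual member tower (members/frames from `hC`, inclusions from K1♯†)
  have hwan : ∃ k : ℕ, ∀ G ∈ (AcSelmer.XAc.charIdeal (W'.baseChange K) 3 κ 𝔭' ∅ γ).map (PowerSeries.map (toUnr 3)),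
      PowerSeries.C (((3 : ℕ) : unrIntegers 3) ^ k) * G ∈ Ideal.span {L} := by
    refine twin_exists_forall_C_pow_mul_mem_span_of_cpIntMemberTower_selfDual_of_isTorsion
      SkinnerUrban2014.prop323_XAc_equiv_XBigDecomp_holds W' N' K hmult hsurj hN' hK hH κ hκ γ 𝔭' h𝔭' hdec hT₀ L hμL
      fun m hm ↦ ?_
    -- RESTATE-ROBUST (pen pss3x g7 sequence T1, 2026-08-29T01:06:02Z): branch 1 reads `hK1` = item 23310 as filed (K1♯†);
    -- branch 2 reads `hK1` = item 23310 restated to K1♯†_T (T2: one more argument, the très-ramifié binder `hndvd`).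
    -- Exactly one branch elaborates at any route rev.
    first
    | exact (hmem m hm).elim fun D hD ↦ hD.elim fun Qm hQ ↦
        ⟨D, Qm, hQ.1, fun b hb hT ↦ hK1 W' N' K Dt' hmult hsurj hN' hK hH hodd κ hκ γ 𝔭 h𝔭 he hf 𝔭' h𝔭' hne ι' hι' m hm D
          hQ.1 hQ.2.2.1 hQ.2.1 b hb
          ΩK (Units.map (R1.unrToCpInt 3 : unrIntegers 3 →* 𝓞_ℂ_[3]) Ωp) Qm hΩK (hΩp' ▸ hQ.2.2.2.1) hT, hQ.2.2.2.2⟩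
    | exact (hmem m hm).elim fun D hD ↦ hD.elim fun Qm hQ ↦
        ⟨D, Qm, hQ.1, fun b hb hT ↦ hK1 W' N' K Dt' hmult hsurj hN' hK hH hodd hndvd κ hκ γ 𝔭 h𝔭 he hf 𝔭' h𝔭' hne ι' hι' m hm D
          hQ.1 hQ.2.2.1 hQ.2.1 b hb
          ΩK (Units.map (R1.unrToCpInt 3 : unrIntegers 3 →* 𝓞_ℂ_[3]) Ωp) Qm hΩK (hΩp' ▸ hQ.2.2.2.1) hT, hQ.2.2.2.2⟩
  -- the degree clause from the Wan clause
  exact degreeClause_of_wanClause hwan g n m hg hprof hprofL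

/-! ### §2 ♭B′° from the print-shaped fact† + K1♯† — the composition of a two-stub line for 22539 -/

/-- **♭B′° `TwinDegreeFrameAtThreeMultTresT` (22539) BY NAME from the weight-controlled print-shaped member/frame fact†
`Castella2018.castella2020_thm211_members_frames_sigma_congruence_odd_nonsplit_wt` (item 23284, = `stub_pubMembersFramesCongruence` of
line membertower v16) and K1♯† (item 23310, = `stub_selfDualMemberRationalInclusionAtThree`) — WITHOUT `stub_thmB`**: §1 ∘ (4)† §2
`allSplitWtMembersFrames_of_nonsplitWtMembersFrames`. The two remaining stubs of v16 close ♭B′° by `fun hC' hK1 ↦ this hC' hK1`.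
CONDITIONAL on {PUBLISHED reading, K1♯† RESEARCH}; nothing is booked; BSD is proved for no curve.
[cite: Castella2020JIMJ, §2 Def. 2.10, Thm. 2.11] [cite: Castella2018Erratum, §2 (p. 2), Thm. 1.1 hyp. (iii), proof (a)(b)(c) (p. 4)]
[cite: Skinner2016PacificMC, §2.6 (2-6-1), §3.1] -/
theorem twinDegreeFrameAtThreeMultTresT_of_nonsplitWtMembersFrames_of_selfDualMemberRationalInclusion
    (hC' : Castella2018.castella2020_thm211_members_frames_sigma_congruence_odd_nonsplit_wt)
    (hK1 : TwinSelfDualMemberRationalInclusionAtThree) :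
    TwinDegreeFrameAtThreeMultTresT :=
  twinDegreeFrameAtThreeMultTresT_of_allSplitWtMembersFrames_of_selfDualMemberRationalInclusion
    (allSplitWtMembersFrames_of_nonsplitWtMembersFrames hC') hK1

/-! ### §3 The same, in the route's item vocabulary -/

/-- **♭B′° in item words**: `TwinCastellaMembersFramesCongruenceOddInput` (23284) → `TwinSelfDualMemberRationalInclusionAtThree` (23310) →
`TwinDegreeFrameAtThreeMultTresT` (22539) — glue† 23330 `TwinWanFrameMultTresTOfSelfDualMemberTowerChildren` with its head
`TwinHsiehThmBInput` (20711) DROPPED and the conclusion read in the degree currency. [folklore] -/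
theorem twinDegreeFrameAtThreeMultTresT_of_selfDualMemberTowerChildren_tail :
    TwinCastellaMembersFramesCongruenceOddInput → TwinSelfDualMemberRationalInclusionAtThree →
      TwinDegreeFrameAtThreeMultTresT :=
  fun hC' hK1 ↦ twinDegreeFrameAtThreeMultTresT_of_nonsplitWtMembersFrames_of_selfDualMemberRationalInclusion hC' hK1

end Summit.BirchSwinnertonDyer.BirchSwinnertonDyer.Theorems.UniversalToricDescentTwinDegreeFrameAtThreeMultTresTOfSelfDualMemberTower

end
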